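/-
Origin: expansion seat `planner-pub-hodgecm-pohl-g13-0`, handover #10 2026-08-18T14:35:49Z (md5 89e1a29ae8e0b829e4f767e956f8df36, 129 l.; RUN 31 additive leaf; lands AFTER my #8 GaloisSpanSexticClosure (d82eed87) AND #9 GaloisSpanHyperoctahedral (ed1a2ecb); rewrites import Pohl13.GaloisSpanSexticClosure -> HodgeCM.Proofs.Pohlmann.GaloisSpanSexticClosure x1, import Pohl13.GaloisSpanHyperoctahedral -> HodgeCM.Proofs.Pohlmann.GaloisSpanHyperoctahedral x1) (`HOME/pub-hodgecm-pohl-g13/lean/Pohl13/GaloisSpanLowDegree.lean`, md5 89e1a29a, 129 lines);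
landed by the gen-8 packager in gate run 31 as `HodgeCM/Proofs/Pohlmann/GaloisSpanLowDegree.lean` (import ^import Pohl13\.GaloisSpanSexticClosure[ \t]*$→import HodgeCM.Proofs.Pohlmann.GaloisSpanSexticClosure ×1; import ^import Pohl13\.GaloisSpanHyperoctahedral[ \t]*$→import HodgeCM.Proofs.Pohlmann.GaloisSpanHyperoctahedral ×1).
-/
/-
Copyright: pub-hodgecm formalisation cell (harness21, 2026). New file (not vendored).
Origin: HOME/pub-hodgecm-pohl-g13/lean/Pohl13/GaloisSpanLowDegree.lean — session planner-pub-hodgecm-pohl-g13-0 (unit pub-hodgecm-pohl-g13),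
EXPANSION part (b) `PohlmannSpan`, generation 13, file 10.  Intended final place: `HodgeCM/Proofs/Pohlmann/GaloisSpanLowDegree.lean`
(module `HodgeCM.Proofs.Pohlmann.GaloisSpanLowDegree`).  ADDITIVE leaf.  WIP imports `Pohl13.GaloisSpanSexticClosure` and
`Pohl13.GaloisSpanHyperoctahedral` = this seat's files 8 and 9 (rewrite to `import HodgeCM.Proofs.Pohlmann.GaloisSpanSexticClosure` /
`import HodgeCM.Proofs.Pohlmann.GaloisSpanHyperoctahedral` on landing).
-/
import Summits.HodgeConjecture.HodgeCM.Proofs.Pohlmann.GaloisSpanSexticClosure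
import Summits.HodgeConjecture.HodgeCM.Proofs.Pohlmann.GaloisSpanHyperoctahedral

/-!
# The naive Pohlmann span in degree `≤ 6`: one integer decides it

Uniform statement of the low-degree classification of this lineage: for EVERY CM field `F` with `[F:ℚ] ≤ 6`,

  `LIN(F)` (⟺ the naive, old-index-set Pohlmann span at every level)  ⟺  `[F̃:ℚ] ≠ 12`,

where `F̃` is the Galois closure of `F` in `ℂ` (`NonGalois.galSpanCondition_iff_finrank_galoisClosure_ne_twelve_of_finrank_le_six`,
`Universe.forall_naivePohlmannSpanAt_iff_of_finrank_le_six`).  Degree `2`: LIN holds (file 3) and `[F̃:ℚ] ∣ 2` (file 9);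
degree `4`: LIN holds (file 4) and `[F̃:ℚ] ∣ 8`; degree `6`: file 8.  CM fields have even positive degree
(`NonGalois.two_dvd_finrank`, from file 3's `two_mul_ncard_type`).  Also recorded: the a-priori bracket
`[F:ℚ] ∣ [F̃:ℚ] ∣ 2^g · g!` (files 8, 9) as one statement.

Nothing is posited; nothing is cited.
-/

noncomputable section

open scoped TensorProduct NumberField BigOperators
open NumberField NumberField.ComplexEmbedding

attribute [local instance] Classical.propDecidable

namespace HodgeCM

open Literature.AlgebraicGeometry.Motives (CMType HodgeStructure)
open HodgeCM.Pohlmann HodgeCM.GaoUllmo HodgeCM.CMTypeOps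

namespace NonGalois

variable {F : Type} [Field F] [NumberField F] [IsCMField F]

/-- A CM field has even degree. -/
theorem two_dvd_finrank : 2 ∣ Module.finrank ℚ F :=
  ⟨(placesType F).1.ncard, (two_mul_ncard_type (placesType F)).symm⟩

/-- A CM field of degree `≤ 6` has degree `2`, `4` or `6`. -/
theorem finrank_eq_or_of_finrank_le_six (h : Module.finrank ℚ F ≤ 6) :
    Module.finrank ℚ F = 2 ∨ Module.finrank ℚ F = 4 ∨ Module.finrank ℚ F = 6 := by
  have hpos : 0 < Module.finrank ℚ F := Module.finrank_pos
  obtain ⟨k, hk⟩ := two_dvd_finrank (F := F)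
  omega

variable (F) in
/-- **`[F:ℚ] ∣ [F̃:ℚ] ∣ 2^g · g!`** (files 8 and 9 combined). -/
theorem finrank_dvd_finrank_galoisClosure_dvd :
    Module.finrank ℚ F ∣ Module.finrank ℚ (galoisClosure (Fin (0 + 1) → F)) ∧
      Module.finrank ℚ (galoisClosure (Fin (0 + 1) → F)) ∣ 2 ^ (Module.finrank ℚ F / 2) * (Module.finrank ℚ F / 2).factorial :=
  ⟨finrank_dvd_finrank_galoisClosure F, finrank_galoisClosure_dvd_two_pow_mul_factorial F⟩

/-- Quadratic (imaginary) fields: `[F̃:ℚ] = 2`. -/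
theorem finrank_galoisClosure_eq_two_of_finrank_eq_two (h2 : Module.finrank ℚ F = 2) :
    Module.finrank ℚ (galoisClosure (Fin (0 + 1) → F)) = 2 := by
  obtain ⟨h1, hd⟩ := finrank_dvd_finrank_galoisClosure_dvd F
  rw [h2] at h1 hd
  have h22 : 2 ^ (2 / 2) * (2 / 2).factorial = 2 := by decide
  rw [h22] at hd
  exact Nat.dvd_antisymm hd h1

/-- Quartic CM fields: `[F̃:ℚ] = 4` or `8`. -/
theorem finrank_galoisClosure_eq_or_of_finrank_eq_four (h4 : Module.finrank ℚ F = 4) :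
    Module.finrank ℚ (galoisClosure (Fin (0 + 1) → F)) = 4 ∨ Module.finrank ℚ (galoisClosure (Fin (0 + 1) → F)) = 8 := by
  obtain ⟨h1, hd⟩ := finrank_dvd_finrank_galoisClosure_dvd F
  rw [h4] at h1 hd
  have h8 : 2 ^ (4 / 2) * (4 / 2).factorial = 8 := by decide
  rw [h8] at hd
  have hle : Module.finrank ℚ (galoisClosure (Fin (0 + 1) → F)) ≤ 8 := Nat.le_of_dvd (by norm_num) hd
  have hpos : 0 < Module.finrank ℚ (galoisClosure (Fin (0 + 1) → F)) := Module.finrank_pos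
  obtain ⟨a, ha⟩ := h1
  omega

/-- **THEOREM (degree `≤ 6`).**  For a CM field `F` of degree at most `6`, the Galois span condition `LIN_m(F)` holds iff
the Galois closure of `F` does not have degree `12`. -/
theorem galSpanCondition_iff_finrank_galoisClosure_ne_twelve_of_finrank_le_six (h : Module.finrank ℚ F ≤ 6) (m : ℕ) :
    GalSpanCondition F m ↔ Module.finrank ℚ (galoisClosure (Fin (0 + 1) → F)) ≠ 12 := by
  rcases finrank_eq_or_of_finrank_le_six h with h2 | h4 | h6
  · refine ⟨fun _ => ?_, fun _ => galSpanCondition_of_finrank_eq_two h2 m⟩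
    rw [finrank_galoisClosure_eq_two_of_finrank_eq_two h2]
    decide
  · refine ⟨fun _ => ?_, fun _ => galSpanCondition_of_finrank_eq_four h4 m⟩
    rcases finrank_galoisClosure_eq_or_of_finrank_eq_four h4 with h' | h' <;> rw [h'] <;> decide
  · exact galSpanCondition_iff_finrank_galoisClosure_ne_twelve h6 m

/-- Degree `≤ 6`, index-set form. -/
theorem indexSetsAgree_iff_of_finrank_le_six (h : Module.finrank ℚ F ≤ 6) :
    (∀ (n : ℕ) (Θ : Fin (n + 1) → CMType F) (p : ℕ), IndexSetsAgree Θ p) ↔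
      Module.finrank ℚ (galoisClosure (Fin (0 + 1) → F)) ≠ 12 := by
  constructor
  · intro hI
    exact (galSpanCondition_iff_finrank_galoisClosure_ne_twelve_of_finrank_le_six h 0).mp
      (galSpanCondition_of_indexSetsAgree 0 hI)
  · intro hne n Θ p
    exact indexSetsAgree_of_galSpanCondition
      ((galSpanCondition_iff_finrank_galoisClosure_ne_twelve_of_finrank_le_six h n).mpr hne) Θ p

end NonGalois

/-! ### Consequence for the naive Pohlmann span -/

namespace Universe

open NonGalois

variable {U : Universe}

/-- **THEOREM (CM fields of degree `≤ 6` and the naive Pohlmann span; model axioms + N1–N3).**  For a CM field `F` with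
`[F:ℚ] ≤ 6`, the naive (old-index-set) Pohlmann span holds for every family of CM types of `F` at every level iff the
Galois closure of `F` in `ℂ` does not have degree `12`.  (Degrees `2`, `4`: always; degree `6`: file 8.) -/
theorem forall_naivePohlmannSpanAt_iff_of_finrank_le_six (M : U.ModelAxioms) (hN1 : U.Fact_cupExterior)
    (hN2 : U.Fact_cup_hodge) (hN3 : U.Fact_pull_H0) (F : CMField) (h : Module.finrank ℚ (F : Type) ≤ 6) :
    (∀ (n : ℕ) (Θ : Fin (n + 1) → CMType F) (p : ℕ), U.NaivePohlmannSpanAt F Θ p) ↔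
      Module.finrank ℚ (galoisClosure (Fin (0 + 1) → (F : Type))) ≠ 12 := by
  rw [forall_naivePohlmannSpanAt_iff_galSpanCondition M hN1 hN2 hN3]
  exact galSpanCondition_iff_finrank_galoisClosure_ne_twelve_of_finrank_le_six h 0

end Universe

end HodgeCM
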